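import Literature.AnabelianGeometry.EtaleTheta.TemperedFrobenioidOfRankOneObject
import Literature.AnabelianGeometry.EtaleTheta.TemperedFrobenioidOfGaloisCoveringTateTower
import Literature.AnabelianGeometry.EtaleTheta.LogDivisorModelTateTowerKummerTwistRootLaw
import Literature.AnabelianGeometry.EtaleTheta.Discharge.Sec4GaloisLiftOfFullEssSurj
import Literature.AnabelianGeometry.EtaleTheta.Discharge.Sec3Prop34iPhiZero
import HarnessLib

/-!
# [EtTh] Def. 3.6 (ii) over the ζ-TWISTED Kummer–Tate tower: the base point is a RANK-ONE OBJECT of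
# `DivisorMonoids.ofTower TateTowerKummerTwist.towerC`, the tempered Frobenioid over it, and A10 with E2 (a) DISCHARGED

S. Mochizuki, *The étale theta function and its Frobenioid-theoretic manifestations*, Publ. RIMS **45** (2009), Def. 3.3 (iii)
p.73 (`Φ₀`, `B₀`, `div₀`; Rmk. 3.3.1: the primes of `Φ₀(Y)` are the Galois orbits of prime log-divisors), Def. 3.6 (i)(ii) pp.76–77,
Def. 4.1 (ii) / Prop. 4.2 (iii) pp.86–89 [cite: MochizukiEtTh2009, Def 3.6 p.77]; S. Mochizuki, *The geometry of Frobenioids II* (2008),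
Ex. 1.1 (the `p`-adic Frobenioid) [cite: MochizukiFrdII2008, Ex. 1.1 p.408].

abc-iut cell, layer L2, seat abc-iut-L2-d2 (gen 6); L2-lead R677/R689/R722 «ζ-TWISTED KUMMER TOWER», sequel to this seat's
`…KummerTwistTower.lean` (`towerC`, p478618) and `…KummerTwistRootLaw.lean` (`rootLawC`, `quotCoverC`).  CLASS (b) MODEL / NON-VACUITY
construction (defs + theorems; 0 instances / notation / `Prop` facts), the EXACT analogue for the ζ-twisted tower of this lineage's
`TemperedFrobenioidOfKummerTateTower.lean` (gen 5, p465559) — engines consumed BY NAME: abc-iut-w5-d179's `dm`-generic rank-one engine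
`TemperedFrobenioid.ofRankOneObject` / `ofRankOneObjectConnectedPart`, abc-iut-w6-d057's `isPerfFactorialCof_phiZero`, abc-iut-w6-d048's
`TateTowerFrd.constDIV` / `val` / `shiftDIV_constDIV` (the log-divisor skeleton is SHARED with the Tate tower), abc-iut-L2-t3's
`baseRootLaw_top_of_rootLaw_of_full_essSurj`.
* `hpfC` — the Prop. 3.4 (i) slot of `ofTower towerC`; `ptC` — the one-point covering `Compat/Compat` (the curve `X` itself); since
  `Compat` acts on log-divisors through the translation `γ` at every level, `Φ₀(ptC)` = the translation-invariant effective
  log-divisors of the chain = `{n·Σ_j [F_j]}`: **`phiZeroPtEquivNat l : (actC l).phiZero (gset ptC) ≃* ℕ`** (any level `l`);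
* `cnstFn l c ∈ B₀(ptC)` — the constant `ϖ_l^c` (invariant: `actFnHom_unif`), in `F₀`; `div₀_cnstFn : div₀(ϖ_lⁿ) = n·Σ_j [F_j]`;
* **`rankOneObjectC : (DivisorMonoids.ofTower towerC).RankOneObject`** (at the level `lvlC ptC` of the base point) and
  **`temperedFrobenioidC R S := TemperedFrobenioid.ofRankOneObject rankOneObjectC hpfC R S`** — a tempered Frobenioid (Def. 3.6 (ii),
  weak vocabulary of record, monoid type `ℤ`) over the ζ-TWISTED tower — the first Frobenioid-carrying tower datum in the tree
  whose constant fields carry ROOTS OF UNITY MOVED by the Galois group (`exists_const_ne_conjC`) — `isFrobenioid_temperedFrobenioidC`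
  ([FrdI] Thm. 5.2 (ii)), re-based over print's `B^temp(Π)⁰` for every `Π` (`nonempty_temperedFrobenioidC_connectedPart`);
* **`baseRootLaw_top_towerC_of_full_essSurj`** — A10 `BaseRootLaw ⊤` for EVERY tempered Frobenioid over `ofRlfZWeak (ofTower towerC) hpfC`
  with full essentially surjective base, E2 (a) DISCHARGED by `rootLawC` (p480574).
HONEST LABEL: a class-(b) design model (NOT the tempered Frobenioid of a Tate curve); `D` one object over the one-point covering —
an instantiation witness; the `IG := «Galois»` form of A10 would need `IsTempered Compat` (sequel); nothing here bears on
[IUTchIII] Cor. 3.12; no side taken; typed ≠ proved.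
-/

noncomputable section

namespace Literature.AnabelianGeometry.EtaleTheta

open CategoryTheory Opposite Function Literature.AlgebraicGeometry.Frobenioids Literature.AnabelianGeometry.SemiGraphs
  Literature.AlgebraicGeometry.Frobenioids.QuasiTemperoid LogDivisorModel LogDivisorModel.GaloisAction LogDivisorModel.TateTower
  LogDivisorModel.TateTowerTwist LogDivisorTower

namespace TateTowerKummerTwist

open TateTowerFrd

/-! ### Prop. 3.4 (i) slot and the one-point covering -/

/-- **Prop. 3.4 (i) (weak-cof) for every `Φ₀(Y)` of the ζ-twisted tower** (abc-iut-w6-d057's `isPerfFactorialCof_phiZero` at the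
level of `Y`). [cite: MochizukiEtTh2009, Prop 3.4 p.74] -/
theorem hpfC (Y : (ConnectedPart (BTemp Compat))ᵒᵖ) : IsPerfFactorialCof ((DivisorMonoids.ofTower towerC).Φ₀.obj Y) :=
  LogDivisorModel.GaloisAction.isPerfFactorialCof_phiZero (actC (lvlC Y.unop)) Y.unop.obj.obj

/-- **The base point of the ζ-twisted tower datum**: the one-point connected tempered covering `Compat/Compat` (the curve `X`).
[cite: MochizukiFrdII2008, Ex 1.3 (ii) p.11] -/
def ptC : ConnectedPart (BTemp Compat) :=
  quotCoverC ⊤ isOpen_univ (by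
    haveI : Subsingleton (Compat ⧸ (⊤ : Subgroup Compat)) := QuotientGroup.subsingleton_quotient_top
    infer_instance)

/-- The point of `Compat/Compat`. [cite: MochizukiEtTh2009, Def 3.3 p.73] -/
def s₀ : (gset ptC).V := ((1 : Compat) : Compat ⧸ (⊤ : Subgroup Compat))

/-- All points of `Compat/Compat` coincide. [cite: MochizukiEtTh2009, Def 3.3 p.73] -/
theorem eq_s₀ (s : (gset ptC).V) : s = s₀ := by
  change @Eq (Compat ⧸ (⊤ : Subgroup Compat)) s s₀
  obtain ⟨a, rfl⟩ := QuotientGroup.mk_surjective s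
  exact QuotientGroup.eq.mpr (Subgroup.mem_top _)

/-- The pure translation `γ^t` as an element of the compatible group (trivial Kummer part and character).
[cite: MochizukiEtTh2009, Def 3.3 (ii) p.73] -/
def transC (t : ℤ) : Compat :=
  ⟨((1 : KC), Multiplicative.ofAdd t),
    ⟨fun i j h => by rw [Prod.fst, SemidirectProduct.one_left, toAdd_one, Pi.zero_apply, Pi.zero_apply, map_zero],
     fun i j h => by rw [Prod.fst, SemidirectProduct.one_right, Pi.one_apply, Pi.one_apply, map_one]⟩⟩

/-- `Compat` translates the chain's log-divisors through `γ`, at every level. [cite: MochizukiEtTh2009, Def 3.3 (iii) p.73] -/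
theorem actC_actDIV_apply (l : ℕ) (g : Compat) (d : TateTower.model.DIV) :
    (actC l).actDIV g d = shiftDIV (Multiplicative.toAdd (g : Grp).2) d := rfl

/-! ### `Φ₀(Compat/Compat) ≅ ℕ` at every level: translation-invariant effective log-divisors are constant -/

section Level

variable (l : ℕ)

/-- The constant effective log-divisor `n·Σ_j [F_j]` as an element of `Φ₀(Compat/Compat)` (level `l`; translation-invariant).
[cite: MochizukiEtTh2009, Def 3.3 p.73] -/
def constPhi (n : ℕ) : (actC l).phiZero (gset ptC) :=
  ⟨fun _ => constDIV n, fun _ => constDIV_mem_Divplus n, fun g _ => by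
    rw [actC_actDIV_apply, shiftDIV_constDIV]⟩

/-- A `Compat`-invariant log-divisor takes the same value on every component (translate by `γⁿ`). [cite: MochizukiEtTh2009, Def 3.3 p.73] -/
theorem val_apply_inr_eq (φ : (actC l).phiZero (gset ptC)) (s : (gset ptC).V) (n : ℤ) :
    val (φ.1 s) (Sum.inr n) = val (φ.1 s₀) (Sum.inr 0) := by
  have h := φ.2.2 (transC n) s
  rw [eq_s₀ ((gset ptC).ρ (transC n) s), eq_s₀ s] at h
  have h' := congrArg (fun d : Multiplicative (TateTower.Idx → ℤ) => val d (Sum.inr n)) h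
  change val (φ.1 s₀) (Sum.inr n) =
    Multiplicative.toAdd (shiftDIV (Multiplicative.toAdd (Multiplicative.ofAdd n)) (φ.1 s₀)) (Sum.inr n) at h'
  rw [toAdd_shiftDIV, toAdd_ofAdd, shiftIdx_symm_inr, sub_self] at h'
  rw [eq_s₀ s]
  exact h'

/-- The multiplicity of `φ ∈ Φ₀(Compat/Compat)` along (any) component. [cite: MochizukiEtTh2009, Def 3.3 p.73] -/
def multAt (φ : (actC l).phiZero (gset ptC)) : ℕ := Int.toNat (val (φ.1 s₀) (Sum.inr 0))

/-- `φ = (multAt φ)·Σ_j [F_j]`. [cite: MochizukiEtTh2009, Def 3.3 p.73] -/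
theorem eq_constPhi_multAt (φ : (actC l).phiZero (gset ptC)) : φ = constPhi l (multAt l φ) := by
  refine Subtype.ext (funext fun s => Multiplicative.toAdd.injective (funext fun x => ?_))
  rcases x with c | n
  · exact c.elim
  · have h0 : (0 : ℤ) ≤ val (φ.1 s₀) (Sum.inr 0) := (φ.2.1 s₀).2 (Sum.inr 0)
    change val (φ.1 s) (Sum.inr n) = val (constDIV ((multAt l φ : ℕ) : ℤ)) (Sum.inr n)
    rw [val_constDIV, val_apply_inr_eq, multAt, Int.toNat_of_nonneg h0]

/-- **`Φ₀(Compat/Compat) ≅ ℕ`** over the ζ-twisted tower: ONE Galois orbit of prime log-divisors (Rmk. 3.3.1), at every level.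
[cite: MochizukiEtTh2009, Rmk 3.3.1 p.73] -/
def phiZeroPtEquivNat : (actC l).phiZero (gset ptC) ≃* Multiplicative ℕ where
  toFun φ := Multiplicative.ofAdd (multAt l φ)
  invFun n := constPhi l (Multiplicative.toAdd n)
  left_inv φ := by
    change constPhi l (Multiplicative.toAdd (Multiplicative.ofAdd (multAt l φ))) = φ
    rw [toAdd_ofAdd]
    exact (eq_constPhi_multAt l φ).symm
  right_inv n := by
    change Multiplicative.ofAdd (Int.toNat (val (constDIV ((Multiplicative.toAdd n : ℕ) : ℤ)) (Sum.inr (0 : ℤ)))) = n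
    rw [val_constDIV, Int.toNat_natCast, ofAdd_toAdd]
  map_mul' φ ψ := by
    rw [← ofAdd_add]
    congr 1
    have hφ : (0 : ℤ) ≤ val (φ.1 s₀) (Sum.inr 0) := (φ.2.1 s₀).2 _
    have hψ : (0 : ℤ) ≤ val (ψ.1 s₀) (Sum.inr 0) := (ψ.2.1 s₀).2 _
    change Int.toNat (val (φ.1 s₀) (Sum.inr 0) + val (ψ.1 s₀) (Sum.inr 0)) = _
    rw [Int.toNat_add hφ hψ]
    rfl

/-! ### `n·Σ_j [F_j] = div₀(ϖ_lⁿ)`: constants and their divisors -/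

/-- The constant function `ϖ_l^c` on the point `Compat/Compat`, an element of `B₀(Compat/Compat)` at level `l` (FIXED by the whole
twist group: `actFnHom_unif`). [cite: MochizukiEtTh2009, Def 3.3 p.73] -/
def cnstFn (c : ℤ) : (actC l).bZero (gset ptC) :=
  ⟨fun _ => unif (MuN l) ^ c, fun _ => trivial, fun g _ => by
    change unif (MuN l) ^ c = actFnHom (rho l (g : Grp)) (unif (MuN l) ^ c)
    rw [map_zpow, actFnHom_unif]⟩

/-- `ϖ_l^c` is a constant (lies in `F₀(Compat/Compat)`). [cite: MochizukiEtTh2009, Def 3.3 p.73] -/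
theorem cnstFn_mem_fZero (c : ℤ) : cnstFn l c ∈ (actC l).fZero (gset ptC) :=
  fun _ => Subgroup.zpow_mem _ (unif_mem_const (MuN l)) c

/-- `div₀(ϖ_lⁿ) = n·Σ_j [F_j]` over the ζ-twisted tower (the root-of-unity coordinate has trivial divisor).
[cite: MochizukiEtTh2009, Def 3.3 p.73] -/
theorem div₀_cnstFn (n : ℕ) :
    (actC l).divZeroHom (gset ptC) (cnstFn l n) = Algebra.GrothendieckGroup.of (constPhi l n) :=
  (((actC l).divZeroHom_eq_div_iff _ _ (constPhi l n) 1).2 fun s => by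
    change (actC l).divAt (gset ptC) (cnstFn l n) s * 1 = constDIV (n : ℤ)
    rw [mul_one]
    refine Multiplicative.toAdd.injective (funext fun x => ?_)
    change Multiplicative.toAdd (divHom ((Multiplicative.ofAdd (((1 : ℤ), (0 : ℤ)))) ^ (n : ℤ))) x = val (constDIV (n : ℤ)) x
    rw [toAdd_divHom, toAdd_zpow, toAdd_ofAdd, val_constDIV]
    simp).trans (by simp only [map_one, div_one])

end Level

/-! ### The rank-one object and the tempered Frobenioid over the ζ-twisted tower -/

/-- **The base point `Compat/Compat` is a RANK-ONE OBJECT of the ζ-twisted tower datum** (`Φ₀ ≅ ℕ`; every log-divisor the divisor of a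
power of the uniformiser), at its level `lvlC ptC`. [cite: MochizukiEtTh2009, Def 3.3 p.73] -/
def rankOneObjectC : (DivisorMonoids.ofTower towerC).RankOneObject where
  Y₀ := ptC
  e := phiZeroPtEquivNat (lvlC ptC)
  hcnst m := ⟨cnstFn (lvlC ptC) (multAt (lvlC ptC) m), cnstFn_mem_fZero _ _,
    (div₀_cnstFn (lvlC ptC) (multAt (lvlC ptC) m)).trans
      (congrArg Algebra.GrothendieckGroup.of (eq_constPhi_multAt (lvlC ptC) m)).symm⟩

variable (R S : ((Discrete PUnit.{1})ᵒᵖ ⥤ CommMonCat.{0}) → Prop)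

/-- **A tempered Frobenioid (Def. 3.6 (ii), weak vocabulary of record, monoid type `ℤ`) over the ζ-TWISTED Kummer–Tate tower** at its
base point: abc-iut-w5-d179's `dm`-generic rank-one engine at `rankOneObjectC`; every condition PROVED.
[cite: MochizukiEtTh2009, Def 3.6 p.77] -/
def temperedFrobenioidC :
    TemperedFrobenioid (RealifiedDivisorMonoids.ofRlfZWeak (DivisorMonoids.ofTower towerC) hpfC) (Discrete PUnit.{1})
      (treeCatVocab (Discrete PUnit.{1}) R S) :=
  TemperedFrobenioid.ofRankOneObject rankOneObjectC hpfC R S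

/-- **NON-VACUITY over the ζ-twisted tower**: «for every tempered Frobenioid over `ofRlfZWeak (ofTower towerC) hpfC`» quantifies
over an inhabited class. [cite: MochizukiEtTh2009, Def 3.6 p.77] -/
theorem nonempty_temperedFrobenioidC :
    Nonempty (TemperedFrobenioid (RealifiedDivisorMonoids.ofRlfZWeak (DivisorMonoids.ofTower towerC) hpfC) (Discrete PUnit.{1})
      (treeCatVocab (Discrete PUnit.{1}) R S)) :=
  ⟨temperedFrobenioidC R S⟩

/-- **«`C` is a Frobenioid» over the ζ-twisted tower** ([FrdI] Thm. 5.2 (ii), via the engine).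
[cite: MochizukiFrdI2008, Thm. 5.2 (ii) p.100] -/
theorem isFrobenioid_temperedFrobenioidC : PreFrobenioid.IsFrobenioid (temperedFrobenioidC R S).toElem :=
  TemperedFrobenioid.isFrobenioid_ofRankOneObject rankOneObjectC hpfC R S

/-- `Φ` of the witness is `im(Φ₀(ptC)^pf → Φ₀(ptC)^rlf)` (print's choice of `Φ`, Ex. 3.9 (iii)). [cite: MochizukiEtTh2009, Def 3.6 p.77] -/
theorem temperedFrobenioidC_Φ_carrier (X : (Discrete PUnit.{1})ᵒᵖ) :
    (temperedFrobenioidC R S).Φ.carrier X = rankOneObjectC.pfImage hpfC := rfl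

variable (Γ : Type) [Group Γ] [TopologicalSpace Γ] (R' S' : ((ConnectedPart (BTemp Γ))ᵒᵖ ⥤ CommMonCat.{0}) → Prop)

/-- **… re-based over print's GENUINE base `B^temp(Π)⁰` for EVERY topological group `Π`** (the engine's `ofRankOneObjectConnectedPart`).
[cite: MochizukiEtTh2009, Def 3.6 p.77] -/
theorem nonempty_temperedFrobenioidC_connectedPart :
    Nonempty (TemperedFrobenioid (RealifiedDivisorMonoids.ofRlfZWeak (DivisorMonoids.ofTower towerC) hpfC)
      (ConnectedPart (BTemp Γ)) (treeCatVocab (ConnectedPart (BTemp Γ)) R' S')) :=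
  ⟨TemperedFrobenioid.ofRankOneObjectConnectedPart rankOneObjectC hpfC (fun _ => True) (fun _ => True) Γ R' S'⟩

/-! ### A10 `BaseRootLaw ⊤` over the ζ-twisted tower, E2 (a) discharged -/

universe u₀ v₀

variable {D : Type u₀} [Category.{v₀} D] {VD : FrdICatStub.{u₀, v₀, 0} D}

/-- **A10 `BaseRootLaw ⊤` over the ζ-twisted Kummer–Tate tower, NO E2 hypothesis**: for every tempered Frobenioid over the type-`ℤ`
weak realified data of `ofTower towerC` whose base functor is full and essentially surjective, every object's base admits the
root-lift property of Def. 4.1 (ii) (abc-iut-L2-t3's `baseRootLaw_top_of_rootLaw_of_full_essSurj` fed with `rootLawC`).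
[cite: MochizukiEtTh2009, Prop 4.2 (iii) p.89] -/
theorem baseRootLaw_top_towerC_of_full_essSurj
    (tf : TemperedFrobenioid (RealifiedDivisorMonoids.ofRlfZWeak (DivisorMonoids.ofTower towerC) hpfC) D VD)
    [tf.base.Full] [tf.base.EssSurj] : tf.BaseRootLaw fun _ => True :=
  tf.baseRootLaw_top_of_rootLaw_of_full_essSurj rootLawC

end TateTowerKummerTwist

end Literature.AnabelianGeometry.EtaleTheta

end
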